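import Mathlib

/-!
# Crux `TateFamilyKernel` (stmt-KontsevichZagierPeriods-9130), line `Sketch`:
# stub `stub_wallRemoval` (wave 14 — wall removal)

Variables: `X 0 = s`, `X 1 = ϖ`, polynomials in `MvPolynomial (Fin 2) ℚ`. A primitive
`E = N/(c(ϖ)·D)` produced by Hermite reduction over `ℚ(ϖ)` may have "walls" — real roots of the
denominator `c ∈ ℚ[ϖ]` inside `[0, ϖ₀]` — although the *function* `e = E` is continuous on the band
`[0,1] × [0,ϖ₀]` and satisfies `e·c(ϖ)·D = N` there. The stub removes them: there are `N', c'` with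
`c'` free of roots in `[0, ϖ₀]` and `c'·N = c·N'`. (`ϖ₀ > 0` is needed: for the degenerate band
`ϖ₀ = 0` the statement fails with `c = ϖ²`, `N = ϖ`, `D = 1`.)

Proof (strong induction on `deg c`). If `c` has a root `ϖ₁ ∈ [0, ϖ₀]`, then `N(s, ϖ₁) = 0` for all
`s ∈ [0,1]`, hence every `s`-coefficient of `N` (an element of `ℚ[ϖ]`) vanishes at the algebraic
number `ϖ₁` (a real polynomial with infinitely many roots is zero), so the minimal polynomial `m`
of `ϖ₁` divides all of them: `N = m(ϖ)·N₁`; also `c = m·c₁` with `deg c₁ < deg c`. The relation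
`(e·c₁·D)·m = N₁·m` on the band gives `e·c₁·D = N₁` off the finitely many real roots of `m`, hence
on the whole band by continuity (`ϖ₀ > 0`), and the induction hypothesis applies to `(c₁, N₁)`.

* `WallRemoval.aeval_eq_eval_finSuccEquiv` — `N(s,ϖ)` through `finSuccEquiv` (coefficients at
  `ϖ`, then the outer variable at `s`);
* `WallRemoval.aeval_coeff_eq_zero` — `N(·,ϖ₁) ≡ 0` on `[0,1]` forces all `s`-coefficients to
  vanish at `ϖ₁`;
* `WallRemoval.aeval_minpoly_dvd` — a `Q ∈ ℚ[ϖ]` (as `MvPolynomial (Fin 1) ℚ`) vanishing at `ϖ₁`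
  is divisible by `m(ϖ)`;
* `WallRemoval.exists_eq_minpoly_mul` — the factorisation `N = m(ϖ)·N₁`;
* `WallRemoval.eqOn_of_mul_aeval` — cancelling a nonzero `m(ϖ)` from a relation between
  continuous functions on `[0, ϖ₀]`;
* `WallRemoval.induct` — the induction on `deg c`.

Mathlib only; no named fact, no new definition. Helpers live in the sub-namespace `WallRemoval`.
-/

noncomputable section

open MeasureTheory Set MvPolynomial

namespace Summit.KontsevichZagierPeriods.InverseLandau.TateFamilyKernel.Descent

namespace WallRemoval

/-- `finSuccEquiv` on constants (`n = 1`). [folklore] -/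
theorem finSuccEquiv_C_one (a : ℚ) :
    finSuccEquiv ℚ 1 (C a : MvPolynomial (Fin 2) ℚ) = Polynomial.C (C a) := by
  simp [finSuccEquiv_apply]

/-- Evaluation of `N ∈ ℚ[s, ϖ]` at a real point `(s, ϖ)` through `finSuccEquiv`: evaluate the
`s`-coefficients (elements of `ℚ[ϖ] = MvPolynomial (Fin 1) ℚ`) at `ϖ`, then the outer variable at
`s`. [folklore] -/
theorem aeval_eq_eval_finSuccEquiv (s ϖ : ℝ) (N : MvPolynomial (Fin 2) ℚ) :
    aeval (![s, ϖ] : Fin 2 → ℝ) N =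
      ((finSuccEquiv ℚ 1 N).map (eval₂Hom (algebraMap ℚ ℝ) (![ϖ] : Fin 1 → ℝ))).eval s := by
  rw [Polynomial.eval_map]
  induction N using MvPolynomial.induction_on with
  | C a => rw [finSuccEquiv_C_one, Polynomial.eval₂_C, eval₂Hom_C, aeval_C]
  | add p q hp hq => rw [map_add, map_add, Polynomial.eval₂_add, hp, hq]
  | mul_X p i hp =>
    rw [map_mul, map_mul, Polynomial.eval₂_mul, hp, aeval_X]
    congr 1
    refine Fin.cases ?_ (fun j => ?_) i
    · rw [finSuccEquiv_X_zero, Polynomial.eval₂_X, Matrix.cons_val_zero]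
    · rw [finSuccEquiv_X_succ, Polynomial.eval₂_C, eval₂Hom_X', Matrix.cons_val_succ]

/-- If `N(s, ϖ₁) = 0` for all `s ∈ [0,1]`, then every `s`-coefficient of `N` vanishes at `ϖ₁`
(a real polynomial with infinitely many roots is zero). [folklore] -/
theorem aeval_coeff_eq_zero (ϖ₁ : ℝ) (N : MvPolynomial (Fin 2) ℚ)
    (h : ∀ s ∈ Icc (0 : ℝ) 1, aeval (![s, ϖ₁] : Fin 2 → ℝ) N = 0) (i : ℕ) :
    aeval (![ϖ₁] : Fin 1 → ℝ) ((finSuccEquiv ℚ 1 N).coeff i) = 0 := by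
  have hP : (finSuccEquiv ℚ 1 N).map (eval₂Hom (algebraMap ℚ ℝ) (![ϖ₁] : Fin 1 → ℝ)) = 0 := by
    refine Polynomial.eq_zero_of_infinite_isRoot _
      ((Icc_infinite (zero_lt_one' ℝ)).mono fun s hs => ?_)
    rw [mem_setOf_eq, Polynomial.IsRoot.def, ← aeval_eq_eval_finSuccEquiv]
    exact h s hs
  have hi := congrArg (fun P : Polynomial ℝ => P.coeff i) hP
  simp only [Polynomial.coeff_map, Polynomial.coeff_zero] at hi
  rw [aeval_def]
  exact hi

/-- A polynomial `Q ∈ ℚ[ϖ]` (written in `MvPolynomial (Fin 1) ℚ`) vanishing at the real number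
`ϖ₁` is divisible by (the image of) the minimal polynomial of `ϖ₁`. [folklore] -/
theorem aeval_minpoly_dvd (ϖ₁ : ℝ) (Q : MvPolynomial (Fin 1) ℚ)
    (h : aeval (![ϖ₁] : Fin 1 → ℝ) Q = 0) :
    Polynomial.aeval (X 0 : MvPolynomial (Fin 1) ℚ) (minpoly ℚ ϖ₁) ∣ Q := by
  -- `ℚ[ϖ] → ℚ[X] → ℚ[ϖ]` is the identity
  have hback : Polynomial.aeval (X 0 : MvPolynomial (Fin 1) ℚ)
      (aeval (fun _ : Fin 1 => (Polynomial.X : Polynomial ℚ)) Q) = Q := by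
    have hcomp : (Polynomial.aeval (X 0 : MvPolynomial (Fin 1) ℚ)).comp
        (aeval fun _ : Fin 1 => (Polynomial.X : Polynomial ℚ)) = AlgHom.id ℚ _ := by
      refine MvPolynomial.algHom_ext fun i => ?_
      rw [AlgHom.comp_apply, aeval_X, Polynomial.aeval_X, AlgHom.id_apply, Fin.fin_one_eq_zero i]
    exact AlgHom.congr_fun hcomp Q
  -- the root `ϖ₁` transported to `ℚ[X]`
  have hvec : (fun _ : Fin 1 => ϖ₁) = ![ϖ₁] := by
    ext i
    simp
  have hroot : Polynomial.aeval ϖ₁ (aeval (fun _ : Fin 1 => (Polynomial.X : Polynomial ℚ)) Q) = 0 := by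
    rw [comp_aeval_apply]
    simp only [Polynomial.aeval_X]
    rw [hvec]
    exact h
  have hdvd := map_dvd (Polynomial.aeval (X 0 : MvPolynomial (Fin 1) ℚ)) (minpoly.dvd ℚ ϖ₁ hroot)
  rwa [hback] at hdvd

/-- `finSuccEquiv` turns `p(ϖ) = aeval (X 1) p` into the constant polynomial with value
`aeval (X 0) p ∈ ℚ[ϖ]`. [folklore] -/
theorem finSuccEquiv_aeval_X_one (p : Polynomial ℚ) :
    finSuccEquiv ℚ 1 (Polynomial.aeval (X 1 : MvPolynomial (Fin 2) ℚ) p) =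
      Polynomial.C (Polynomial.aeval (X 0 : MvPolynomial (Fin 1) ℚ) p) := by
  induction p using Polynomial.induction_on' with
  | add p q hp hq => rw [map_add, map_add, hp, hq, map_add, Polynomial.C_add]
  | monomial n a =>
    rw [Polynomial.aeval_monomial, Polynomial.aeval_monomial, map_mul (finSuccEquiv ℚ 1),
      map_pow (finSuccEquiv ℚ 1), AlgEquiv.commutes, Polynomial.algebraMap_apply,
      show (X 1 : MvPolynomial (Fin 2) ℚ) = X (Fin.succ 0) from rfl, finSuccEquiv_X_succ,
      ← Polynomial.C_pow, ← Polynomial.C_mul]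

/-- **Factorisation at a wall.** If `N(s, ϖ₁) = 0` for all `s ∈ [0,1]`, then `N = m(ϖ)·N₁` with
`m` the minimal polynomial of `ϖ₁` over `ℚ`. [folklore] -/
theorem exists_eq_minpoly_mul (ϖ₁ : ℝ) (N : MvPolynomial (Fin 2) ℚ)
    (h : ∀ s ∈ Icc (0 : ℝ) 1, aeval (![s, ϖ₁] : Fin 2 → ℝ) N = 0) :
    ∃ N₁ : MvPolynomial (Fin 2) ℚ,
      N = Polynomial.aeval (X 1 : MvPolynomial (Fin 2) ℚ) (minpoly ℚ ϖ₁) * N₁ := by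
  have hdvd : Polynomial.C (Polynomial.aeval (X 0 : MvPolynomial (Fin 1) ℚ) (minpoly ℚ ϖ₁)) ∣
      finSuccEquiv ℚ 1 N :=
    (Polynomial.C_dvd_iff_dvd_coeff _ _).2 fun i =>
      aeval_minpoly_dvd ϖ₁ _ (aeval_coeff_eq_zero ϖ₁ N h i)
  have hdvd' := map_dvd (finSuccEquiv ℚ 1).symm hdvd
  rw [← finSuccEquiv_aeval_X_one, AlgEquiv.symm_apply_apply, AlgEquiv.symm_apply_apply] at hdvd'
  obtain ⟨N₁, hN₁⟩ := hdvd'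
  exact ⟨N₁, hN₁⟩

/-- `p(ϖ) = aeval (X 1) p` evaluated at a point `(s, ϖ)` of the plane is `p(ϖ)`. [folklore] -/
theorem aeval_aeval_X_one (s ϖ : ℝ) (p : Polynomial ℚ) :
    aeval (![s, ϖ] : Fin 2 → ℝ) (Polynomial.aeval (X 1 : MvPolynomial (Fin 2) ℚ) p) =
      Polynomial.aeval ϖ p := by
  rw [← Polynomial.aeval_algHom_apply, aeval_X, Matrix.cons_val_one, Matrix.cons_val_zero]

/-- `ϖ ↦ P(s, ϖ)` is continuous for every `P ∈ ℚ[s, ϖ]`. [folklore] -/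
theorem continuous_aeval_right (s : ℝ) (P : MvPolynomial (Fin 2) ℚ) :
    Continuous fun ϖ : ℝ => aeval (![s, ϖ] : Fin 2 → ℝ) P := by
  induction P using MvPolynomial.induction_on with
  | C a =>
    simp only [aeval_C]
    exact continuous_const
  | add p q hp hq =>
    simp only [map_add]
    exact hp.add hq
  | mul_X p i hp =>
    simp only [map_mul, aeval_X]
    refine hp.mul ?_
    refine Fin.cases ?_ (fun j => ?_) i
    · simp only [Matrix.cons_val_zero]
      exact continuous_const
    · simp only [Matrix.cons_val_succ, Matrix.cons_val_fin_one]
      exact continuous_id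

/-- **Cancelling a polynomial factor by continuity.** If `f·m = g·m` on `[0, ϖ₀]` (`ϖ₀ > 0`) for
continuous `f, g` and a nonzero `m ∈ ℚ[ϖ]`, then `f = g` on `[0, ϖ₀]`: the real roots of `m` are
finitely many, so equality holds on a dense subset of the nondegenerate interval. [folklore] -/
theorem eqOn_of_mul_aeval {ϖ₀ : ℝ} (hϖ₀ : 0 < ϖ₀) {m : Polynomial ℚ} (hm : m ≠ 0) {f g : ℝ → ℝ}
    (hf : ContinuousOn f (Icc 0 ϖ₀)) (hg : ContinuousOn g (Icc 0 ϖ₀))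
    (h : ∀ ϖ ∈ Icc (0 : ℝ) ϖ₀, f ϖ * Polynomial.aeval ϖ m = g ϖ * Polynomial.aeval ϖ m) :
    ∀ ϖ ∈ Icc (0 : ℝ) ϖ₀, f ϖ = g ϖ := by
  have hdense : Dense {x : ℝ | Polynomial.aeval x m ≠ 0} := by
    have hfin : {x : ℝ | Polynomial.aeval x m = 0}.Finite :=
      (m.rootSet_finite ℝ).subset fun x hx => (Polynomial.mem_rootSet_of_ne hm).2 hx
    have hset : {x : ℝ | Polynomial.aeval x m ≠ 0} = univ \ {x : ℝ | Polynomial.aeval x m = 0} := by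
      ext x
      simp
    rw [hset]
    exact dense_univ.sdiff_finite hfin
  have hsub : Icc (0 : ℝ) ϖ₀ ⊆ closure (Ioo 0 ϖ₀ ∩ {x : ℝ | Polynomial.aeval x m ≠ 0}) := by
    rw [← closure_Ioo hϖ₀.ne]
    exact closure_minimal (hdense.open_subset_closure_inter isOpen_Ioo) isClosed_closure
  have heqOn : EqOn f g (Ioo 0 ϖ₀ ∩ {x : ℝ | Polynomial.aeval x m ≠ 0}) := fun x hx =>
    mul_right_cancel₀ hx.2 (h x (Ioo_subset_Icc_self hx.1))
  exact heqOn.of_subset_closure hf hg (fun x hx => Ioo_subset_Icc_self hx.1) hsub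

/-- **Wall removal, by strong induction on `deg c`.** [folklore] -/
theorem induct (ϖ₀ : ℝ) (hϖ₀ : 0 < ϖ₀) (D : MvPolynomial (Fin 2) ℚ) (e : ℝ × ℝ → ℝ)
    (he : ContinuousOn e (Icc (0 : ℝ) 1 ×ˢ Icc (0 : ℝ) ϖ₀)) (n : ℕ) :
    ∀ (c : Polynomial ℚ) (N : MvPolynomial (Fin 2) ℚ), c.natDegree = n → c ≠ 0 →
      (∀ s ∈ Icc (0 : ℝ) 1, ∀ ϖ ∈ Icc (0 : ℝ) ϖ₀,
        e (s, ϖ) * Polynomial.aeval ϖ c * aeval (![s, ϖ] : Fin 2 → ℝ) D =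
          aeval (![s, ϖ] : Fin 2 → ℝ) N) →
      ∃ (N' : MvPolynomial (Fin 2) ℚ) (c' : Polynomial ℚ),
        (∀ ϖ ∈ Icc (0 : ℝ) ϖ₀, Polynomial.aeval ϖ c' ≠ 0) ∧
        Polynomial.aeval (X 1 : MvPolynomial (Fin 2) ℚ) c' * N =
          Polynomial.aeval (X 1 : MvPolynomial (Fin 2) ℚ) c * N' := by
  refine Nat.strong_induction_on n fun n ih => ?_
  intro c N hdeg hc heq
  by_cases hroot : ∃ ϖ₁ ∈ Icc (0 : ℝ) ϖ₀, Polynomial.aeval ϖ₁ c = 0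
  swap
  · push Not at hroot
    exact ⟨N, c, hroot, rfl⟩
  obtain ⟨ϖ₁, hϖ₁, hcϖ₁⟩ := hroot
  -- the minimal polynomial `minpoly ℚ ϖ₁` of the algebraic number `ϖ₁` divides `c`
  have hint : IsIntegral ℚ ϖ₁ := IsAlgebraic.isIntegral ⟨c, hc, hcϖ₁⟩
  have hm0 : minpoly ℚ ϖ₁ ≠ 0 := minpoly.ne_zero hint
  obtain ⟨c₁, hc₁⟩ : minpoly ℚ ϖ₁ ∣ c := minpoly.dvd ℚ ϖ₁ hcϖ₁
  have hc₁0 : c₁ ≠ 0 := by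
    rintro rfl
    exact hc (by rw [hc₁, mul_zero])
  have hlt : c₁.natDegree < n := by
    rw [← hdeg, hc₁, Polynomial.natDegree_mul hm0 hc₁0]
    have hpos := minpoly.natDegree_pos hint
    omega
  -- `N(·, ϖ₁) ≡ 0` on `[0,1]`, hence `N = m(ϖ)·N₁`
  obtain ⟨N₁, hN₁⟩ := exists_eq_minpoly_mul ϖ₁ N fun s hs => by
    rw [← heq s hs ϖ₁ hϖ₁, hcϖ₁, mul_zero, zero_mul]
  -- the relation for `(c₁, N₁)`, by continuity across the real roots of `m`
  have heq₁ : ∀ s ∈ Icc (0 : ℝ) 1, ∀ ϖ ∈ Icc (0 : ℝ) ϖ₀,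
      e (s, ϖ) * Polynomial.aeval ϖ c₁ * aeval (![s, ϖ] : Fin 2 → ℝ) D =
        aeval (![s, ϖ] : Fin 2 → ℝ) N₁ := by
    intro s hs
    have hes : ContinuousOn (fun ϖ : ℝ => e (s, ϖ)) (Icc 0 ϖ₀) :=
      he.comp (continuous_const.prodMk continuous_id).continuousOn fun ϖ hϖ => ⟨hs, hϖ⟩
    refine eqOn_of_mul_aeval hϖ₀ hm0
      ((hes.mul (Polynomial.continuous_aeval (A := ℝ) c₁).continuousOn).mul
        (continuous_aeval_right s D).continuousOn)
      (continuous_aeval_right s N₁).continuousOn fun ϖ hϖ => ?_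
    have h := heq s hs ϖ hϖ
    rw [hc₁, map_mul, hN₁, map_mul, aeval_aeval_X_one] at h
    linear_combination h
  obtain ⟨N', c', hroots, hrel⟩ := ih c₁.natDegree hlt c₁ N₁ rfl hc₁0 heq₁
  refine ⟨N', c', hroots, ?_⟩
  rw [hN₁, hc₁, map_mul]
  linear_combination (Polynomial.aeval (X 1 : MvPolynomial (Fin 2) ℚ) (minpoly ℚ ϖ₁)) * hrel

end WallRemoval

/-- STUB (wave 14, algebra + continuity). **Wall removal.** If a continuous function `e` on the band
`[0,1] × [0,ϖ₀]` (`ϖ₀ > 0`; false for the degenerate band `ϖ₀ = 0`: `c = ϖ²`, `N = ϖ`) satisfies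
`e·c(ϖ)·D(s,ϖ) = N(s,ϖ)` there (`N, D ∈ ℚ[s,ϖ]`, `c ∈ ℚ[ϖ] ∖ 0`), then the fraction
`N/(cD)` can be rewritten as `N'/(c'D)` with `c'` free of roots in `[0,ϖ₀]`: `c'·N = c·N'`. (At a
root `ϖ₁ ∈ [0,ϖ₀]` of `c` the polynomial `N(·,ϖ₁)` vanishes on `[0,1]`, hence identically, so the
minimal polynomial of the algebraic number `ϖ₁` divides every `s`-coefficient of `N`; cancel it from
`c` and `N` and induct on `deg c` — the relation `e·c₁·D = N₁` persists by continuity.)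
[folklore] -/
theorem stub_wallRemoval (ϖ₀ : ℝ) (hϖ₀ : 0 < ϖ₀) (N D : MvPolynomial (Fin 2) ℚ) (c : Polynomial ℚ)
    (hc : c ≠ 0)
    (e : ℝ × ℝ → ℝ) (he : ContinuousOn e (Icc (0 : ℝ) 1 ×ˢ Icc (0 : ℝ) ϖ₀))
    (heq : ∀ s ∈ Icc (0 : ℝ) 1, ∀ ϖ ∈ Icc (0 : ℝ) ϖ₀,
      e (s, ϖ) * Polynomial.aeval ϖ c * aeval (![s, ϖ] : Fin 2 → ℝ) D = aeval (![s, ϖ] : Fin 2 → ℝ) N) :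
    ∃ (N' : MvPolynomial (Fin 2) ℚ) (c' : Polynomial ℚ),
      (∀ ϖ ∈ Icc (0 : ℝ) ϖ₀, Polynomial.aeval ϖ c' ≠ 0) ∧
      Polynomial.aeval (X 1 : MvPolynomial (Fin 2) ℚ) c' * N =
        Polynomial.aeval (X 1 : MvPolynomial (Fin 2) ℚ) c * N' :=
  WallRemoval.induct ϖ₀ hϖ₀ D e he c.natDegree c N rfl hc heq

end Summit.KontsevichZagierPeriods.InverseLandau.TateFamilyKernel.Descent

end
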